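import Summits.ValiantsHypothesis.ValiantsHypothesis.Theorems.BarrierLeverChowBenchmarkPairsBlockPeelLadder
import Summits.ValiantsHypothesis.ValiantsHypothesis.Theorems.BarrierLeverChowBenchmarkPairsBlockPeelCert363Data1
import Summits.ValiantsHypothesis.ValiantsHypothesis.Theorems.BarrierLeverChowBenchmarkPairsBlockPeelCert363Data2
import Summits.ValiantsHypothesis.ValiantsHypothesis.Theorems.BarrierLeverChowBenchmarkPairsBlockPeelCert363Data3

/-!
# Route BarrierLever — item 22038 `ChowBenchmarkPairs`, line `moore-peel`: COMPUTATIONAL CERTIFICATE (Lean.ofReduceBool) for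
# the tied block `{182, 183}` — `det J^{!}(182,2)(Λ) ≠ 0` — hence `SegmentMeanValueAt h` for EVERY `h ≤ 363`

Helper file, **computational (`Lean.ofReduceBool`)** (`--computational --supports stmt-ValiantsHypothesis-22038`; cell
valiant-natproofs, rung V4, 𝒟-side benchmark of record, line `moore_peel`; seat val-np-p4 gen 29; planner **RULING R43**,
HOME/STATUS.md 2026-08-29T08:13:57Z: a `native_decide` instance for node #1's range extension is sanctioned under (a) isolation of
ONE `native_decide` step `A * B = 1`, (b) two ranges on the card — KERNEL range of node #1 `h ≤ 182` (p690790) vs COMPUTATIONAL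
range `h ≤ 363` (this file) — never merged, (c) independent re-verification of `(p, point, A, B)` (kit j328158; exported data
`HOME/val-np-p4/g29/cert/`).  Closes NO item.

THE CERTIFICATE.  `p = 65521`, point `Λ = (2, 3) ∈ (ℤ/p)²`.
* `cert363A` — the block matrix `J^{!}(182,2)(2,3)` over `ZMod 65521`, i.e. the TREE'S OWN `blockMatrix Nat.factorial 182 2` of
  `…BlockPeelRows` at the point, reindexed to `Fin 365` by `finSigmaFinEquiv` and tabulated once (`Array.ofFn`; `cert363A_eq` is the
  kernel fact that the table IS the reindexed block matrix — no literal for `A`, so no transcription to trust);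
* `cert363B` — the inverse read from the base-64 string `cert363B64` = the three parts of `…BlockPeelCert363Data1/2/3` (kit j328158);
* **`cert363_mul_inv_eq_one : cert363A * cert363B = 1 := by native_decide`** — THE ONLY NON-KERNEL STEP (axiom `Lean.ofReduceBool`);
* kernel from there: `det cert363A` is a unit (`Matrix.isUnit_det_of_right_inverse`) ⇒ `det (blockMatrix k! 182 2 (2,3)) ≠ 0` in `ZMod p`
  (`det_reindex_self`) ⇒ the SYMBOLIC `det (blockMatrix k! 182 2 X) ≠ 0` in `ℤ[Λ_0, Λ_1]` (evaluation is a ring map,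
  `map_det_blockMatrix`) ⇒ **`segmentMeanValueAt_of_le_363_cert`**: the line file's `SegmentMeanValueAt h` VERBATIM for every `h ≤ 363`
  (`segmentMeanValueAt_of_le_363` of `…BlockPeelLadder`: THEOREM W's table + the block peel theorem).

WHAT THIS IS NOT: not a kernel proof (computational lane, `Lean.ofReduceBool`); node #1 `stub_segmentMeanValue` (∀ h) is NOT closed;
nothing on crux stmt-ValiantsHypothesis-14610 or on `VP` versus `VNP`.
-/

set_option linter.dupNamespace false

namespace Summit.ValiantsHypothesis.ValiantsHypothesis.Theorems.BarrierLever.MoorePeel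

open Polynomial Finset

/-! ## 1. The modulus, the point, the two matrices -/

/-- The modulus of the certificate (a prime, though primality is not used). -/
abbrev cert363P : ℕ := 65521

/-- `1 < 65521` (so `ZMod 65521` is nontrivial). -/
instance cert363P_fact : Fact (1 < cert363P) := ⟨by decide⟩

/-- The evaluation point `Λ = (2, 3)`. -/
def cert363Point : Fin 2 → ZMod cert363P := fun s => if s.val = 0 then 2 else 3

/-- `blockWidth 182 2 = 182 + 183 = 365`. -/
theorem blockWidth_182_2 : blockWidth 182 2 = 365 := by
  simp [blockWidth, Fin.sum_univ_two]

/-- The block labels of `J(182,2)` in window order. -/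
def cert363Equiv : BlockIdx 182 2 ≃ Fin 365 := finSigmaFinEquiv.trans (finCongr blockWidth_182_2)

/-- `J^{!}(182,2)(2,3)` over `ZMod 65521`, reindexed to `Fin 365` (rows and columns in `finSigmaFinEquiv` order). -/
def cert363A0 : Matrix (Fin 365) (Fin 365) (ZMod cert363P) :=
  Matrix.reindex cert363Equiv cert363Equiv (blockMatrix Nat.factorial 182 2 cert363Point)

/-- Row `r` of the table of `cert363A0`. -/
def cert363Arow (r : Fin 365) : Array (ZMod cert363P) := Array.ofFn fun c : Fin 365 => cert363A0 r c

/-- The table of `cert363A0` (computed once). -/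
def cert363Atab : Array (Array (ZMod cert363P)) := Array.ofFn cert363Arow

/-- **`A`** = the tabulated block matrix. -/
def cert363A : Matrix (Fin 365) (Fin 365) (ZMod cert363P) := fun r c =>
  (cert363Atab.getD r.val #[]).getD c.val 0

/-- KERNEL FACT: the table is the reindexed block matrix (`Array.getElem?_ofFn`, no evaluation). -/
theorem cert363A_eq : cert363A = cert363A0 := by
  funext r c
  simp only [cert363A, cert363Atab, cert363Arow, Array.getD_eq_getD_getElem?, Array.getElem?_ofFn, r.2, c.2, dif_pos,
    Option.getD_some]

/-- Base-64 digit value (alphabet `A–Z a–z 0–9 + /`). -/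
def b64val (ch : Char) : ℕ :=
  if 'A' ≤ ch ∧ ch ≤ 'Z' then ch.toNat - 'A'.toNat
  else if 'a' ≤ ch ∧ ch ≤ 'z' then ch.toNat - 'a'.toNat + 26
  else if '0' ≤ ch ∧ ch ≤ '9' then ch.toNat - '0'.toNat + 52
  else if ch = '+' then 62 else 63

/-- The base-64 text of `B`: the three data parts, one row per line. -/
def cert363B64 : String := cert363B64p1 ++ "\n" ++ cert363B64p2 ++ "\n" ++ cert363B64p3

/-- The decoded table of `B` (365 rows of 365 naturals `< 65521`). -/
def cert363Btab : Array (Array ℕ) :=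
  (((cert363B64.splitOn "\n").filter fun l => decide (0 < l.length)).toArray).map fun line =>
    let cs := line.toList.toArray
    Array.ofFn fun m : Fin 365 =>
      b64val (cs.getD (3 * m.val) 'A') * 4096 + b64val (cs.getD (3 * m.val + 1) 'A') * 64 +
        b64val (cs.getD (3 * m.val + 2) 'A')

/-- **`B`** = the inverse of `A` modulo `65521` (kit j328158), read from `cert363B64`. -/
def cert363B : Matrix (Fin 365) (Fin 365) (ZMod cert363P) := fun r c =>
  (((cert363Btab.getD r.val #[]).getD c.val 0 : ℕ) : ZMod cert363P)

/-! ## 2. The single computational step -/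

/-- **THE CERTIFICATE CHECK (computational, `Lean.ofReduceBool`)**: `A * B = 1` over `ZMod 65521`. -/
theorem cert363_mul_inv_eq_one : cert363A * cert363B = 1 := by
  native_decide

/-! ## 3. Kernel consequences -/

/-- `det J^{!}(182,2)(2,3) ≠ 0` in `ZMod 65521`. -/
theorem det_blockMatrix_182_2_point_ne_zero : (blockMatrix Nat.factorial 182 2 cert363Point).det ≠ 0 := by
  have h : IsUnit cert363A0.det := by
    rw [← cert363A_eq]
    exact Matrix.isUnit_det_of_right_inverse cert363_mul_inv_eq_one
  rw [cert363A0, Matrix.det_reindex_self] at h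
  exact h.ne_zero

/-- **The symbolic block determinant of the tied block `{182,183}` is nonzero**: `det J^{!}(182,2)(Λ_0,Λ_1) ≠ 0` in `ℤ[Λ]`
(computational, via the point `(2,3)` modulo `65521`). -/
theorem det_blockMatrix_182_2_ne_zero :
    (blockMatrix Nat.factorial 182 2 (fun s : Fin 2 => (MvPolynomial.X s : MvPolynomial (Fin 2) ℤ))).det ≠ 0 := by
  intro h0
  apply det_blockMatrix_182_2_point_ne_zero
  have e := map_det_blockMatrix (MvPolynomial.eval₂Hom (Int.castRingHom (ZMod cert363P)) cert363Point)
    Nat.factorial 182 2 (fun s : Fin 2 => (MvPolynomial.X s : MvPolynomial (Fin 2) ℤ))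
  rw [h0, map_zero] at e
  simp only [MvPolynomial.coe_eval₂Hom, MvPolynomial.eval₂_X] at e
  exact e.symm

/-- **`KernelPoisedAt k! h` for every `h ≤ 363`** (computational lane). -/
theorem kernelPoisedAt_factorial_of_le_363_cert (h : ℕ) (hh : h ≤ 363) : KernelPoisedAt Nat.factorial h :=
  kernelPoisedAt_factorial_of_le_363 det_blockMatrix_182_2_ne_zero h hh

/-- **`SegmentMeanValueAt h` for EVERY `h ≤ 363`, VERBATIM (computational lane, `Lean.ofReduceBool`)** — node #1's statement
on `[0, 363]`: THEOREM W + the block peel theorem + the certified tied block `{182, 183}`. -/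
theorem segmentMeanValueAt_of_le_363_cert (h : ℕ) (hh : h ≤ 363) :
    ∀ (r : ℕ) (u : Fin r → Finset (Fin h)), Function.Injective u → (∀ i, (u i).card ≤ 2) →
      (∀ S : Finset (Fin h), S.card ≤ 2 → ∃ i, u i = S) →
      ∃ P : Fin h → Fin h → ℂ,
        (Matrix.of fun i j : Fin r =>
          ∑ g : (↥(benchCols h r j) → ↥(u i)), (∏ c : ↥(benchCols h r j), P (g c) c) *
            ∏ a : ↥(u i),
              ((Finset.univ.filter fun c : ↥(benchCols h r j) => g c = a).card.factorial : ℂ)).det ≠ 0 :=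
  segmentMeanValueAt_of_le_363 det_blockMatrix_182_2_ne_zero h hh

end Summit.ValiantsHypothesis.ValiantsHypothesis.Theorems.BarrierLever.MoorePeel
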